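import Summits.QuantumFields.BalabanUV.T4Continuum.Spine.NE2.OneStepRemainderCoefficients
import Literature.Analysis.Complex.RungeUnits
import Literature.MathematicalPhysics.QuantumFieldTheory.Balaban1983to89.MatrixLog
import Summits.QuantumFields.BalabanUV.T4Continuum.Support.TermwiseBackground

/-!
# T⁴ programme, spine node NE2 (U1a) — R14 W3c″, file 1: LIPSCHITZ BOUNDS FOR [B7] §A's FUNCTIONAL CALCULUS — `g`, the Neumann inverse, `exp`, and the three coefficient shapes of (124)
# (cell `pub-balaban-gaps`, seat ne2 gen 6)

The cross-problem letters `δG k i` of `ComposedRemainderTwoLevel.composed_full_averaging_rate_of_letters` bound `‖G_i^{(k+1)} − G_i^{(k)}‖`, the difference of (124)'s coefficient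
operators built from two backgrounds (the problems at levels `k+1` and `k`).  With `G₁ = g(A)g(B)⁻¹ − 1`, `G₂ = g(A)g(B)⁻¹e^{C} − 1`, `G₃ = e^{C} − g(A)·Σ_x w_x g(B_x)⁻¹`
(`OneStepRemainderCoefficients`, [B7] (33) `g(z) = (e^{−z} − 1)/(−z)`), such a bound is the LIPSCHITZ continuity of the functional calculus on the small ball, which THIS FILE records in
an abstract complete normed `ℂ`-algebra with `‖1‖ = 1`:
 * **`norm_gFun_sub_gFun_le`**: `‖g(A) − g(B)‖ ≤ e^{max(‖A‖,‖B‖)}·‖A − B‖` (termwise, `‖Aⁿ⁺¹ − Bⁿ⁺¹‖ ≤ (n+1)Mⁿ‖A − B‖` = `RungeUnits.norm_pow_succ_sub_pow_succ_le`);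
 * **`norm_inverse_sub_inverse_le`**: `‖a⁻¹ − b⁻¹‖ ≤ 4‖a − b‖` for `‖a − 1‖, ‖b − 1‖ ≤ 1/2` (Neumann: `‖a⁻¹‖ ≤ 2`);
 * products (the tree's `TermwiseBackground.norm_mul_sub_mul_le'`) and the exponential (`RungeUnits.norm_exp_sub_exp_le`); **`norm_mlog_sub_mlog_le`**: `‖log X − log X′‖ ≤ 2‖X − X′‖` for `‖X − 1‖, ‖X′ − 1‖ ≤ 1/2` ((21)/(26),
   termwise from the logarithmic series);
 * **`norm_coeff₁_sub_le`**, **`norm_coeff₂_sub_le`**, **`norm_coeff₃_sub_le`**: on the ball `‖·‖ ≤ y ≤ 1/4`, if the arguments differ by at most `δ` then the coefficients differ by at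
   most `24·δ` (a common crude constant).
Companion (matrix level): `adLie` is real-linear, so `‖ad_Y − ad_{Y′}‖ ≤ 2‖Y − Y′‖`, and the loop logarithms are Lipschitz in the bond data — giving `δG` from NE3-type closeness letters of
the fundamental fields.
HONEST FRAMING (T4-DAG p. 1).  [folklore] normed-algebra calculus; nothing of Bałaban's asserted; NOT NE2; **NE2 (U1a) NOT PROVED**; spine PROVED 0/9 unchanged; NOT continuum YM /
infinite volume / mass gap / Clay.  No `sorry`.
-/

noncomputable section

open scoped BigOperators
open Nat NormedSpace

namespace Summit.QuantumFields.BalabanUV.T4Continuum.NE2.OneStepRemainderCoefficientsLipschitz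

open Summit.QuantumFields.BalabanUV.T4Continuum.NE2.OneStepRemainderCoefficients (gFun summable_gFun norm_gFun_sub_one_le norm_inverse_sub_one_le exp_sub_one_le_two_mul)
open Literature.Analysis.Complex (norm_pow_succ_sub_pow_succ_le norm_exp_sub_exp_le logSeriesCoeff logSeriesCoeff_zero norm_logSeriesCoeff_le)
open Literature.MathematicalPhysics.QuantumFieldTheory.Balaban1983to89.MatrixLog (mlog hasSum_mlog)
open Literature.Analysis.Calculus (norm_exp_sub_one_le)
open Summit.QuantumFields.BalabanUV.T4Continuum.TermwiseBackground (norm_mul_sub_mul_le')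

variable {𝔸 : Type*} [NormedRing 𝔸] [NormedAlgebra ℂ 𝔸] [CompleteSpace 𝔸] [NormOneClass 𝔸]

/-! ## §1 `g` is locally Lipschitz -/

/-- the real majorant of the termwise differences of `g`: `0, δ, Mδ, M²δ/2!, …`. [folklore] -/
def gLipTerm (M δ : ℝ) (n : ℕ) : ℝ := if n = 0 then 0 else M ^ (n - 1) / ((n - 1)! : ℝ) * δ

omit [CompleteSpace 𝔸] in
/-- termwise: `‖((−1)ⁿ/(n+1)!)(Aⁿ − Bⁿ)‖ ≤ gLipTerm M ‖A − B‖ n` for `M = max(‖A‖, ‖B‖)`. [folklore] -/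
theorem norm_gTerm_sub_le (A B : 𝔸) (n : ℕ) :
    ‖((-1 : ℂ) ^ n / ((n + 1)! : ℂ)) • (A ^ n - B ^ n)‖ ≤ gLipTerm (max ‖A‖ ‖B‖) ‖A - B‖ n := by
  cases n with
  | zero => simp [gLipTerm]
  | succ m =>
    have hM0 : 0 ≤ max ‖A‖ ‖B‖ := le_max_of_le_left (norm_nonneg _)
    rw [gLipTerm, if_neg (Nat.succ_ne_zero m), Nat.add_sub_cancel, norm_smul, norm_div, norm_pow, norm_neg, norm_one, one_pow, Complex.norm_natCast, one_div]
    have h1 := norm_pow_succ_sub_pow_succ_le A B m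
    have hfac : (((m + 1 + 1)! : ℕ) : ℝ) = (m + 2 : ℝ) * (m + 1) * (m ! : ℝ) := by
      rw [Nat.factorial_succ, Nat.factorial_succ]; push_cast; ring
    have hmf : (0 : ℝ) < (m ! : ℝ) := by exact_mod_cast Nat.factorial_pos m
    rw [hfac]
    have hkey : ((m + 2 : ℝ) * (m + 1) * (m ! : ℝ))⁻¹ * ((m + 1) * max ‖A‖ ‖B‖ ^ m * ‖A - B‖) ≤ max ‖A‖ ‖B‖ ^ m / (m ! : ℝ) * ‖A - B‖ := by
      rw [div_eq_mul_inv]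
      have hx : 0 ≤ max ‖A‖ ‖B‖ ^ m * ‖A - B‖ := mul_nonneg (pow_nonneg hM0 _) (norm_nonneg _)
      have e1 : ((m + 2 : ℝ) * (m + 1) * (m ! : ℝ))⁻¹ * ((m + 1) * max ‖A‖ ‖B‖ ^ m * ‖A - B‖)
          = (max ‖A‖ ‖B‖ ^ m * ‖A - B‖) * ((m ! : ℝ))⁻¹ * (m + 2 : ℝ)⁻¹ := by
        field_simp
      rw [e1]
      have h2 : (m + 2 : ℝ)⁻¹ ≤ 1 := inv_le_one_of_one_le₀ (by linarith)
      calc max ‖A‖ ‖B‖ ^ m * ‖A - B‖ * ((m ! : ℝ))⁻¹ * (m + 2 : ℝ)⁻¹ ≤ max ‖A‖ ‖B‖ ^ m * ‖A - B‖ * ((m ! : ℝ))⁻¹ * 1 :=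
            mul_le_mul_of_nonneg_left h2 (mul_nonneg hx (by positivity))
        _ = max ‖A‖ ‖B‖ ^ m * ((m ! : ℝ))⁻¹ * ‖A - B‖ := by ring
    exact (mul_le_mul_of_nonneg_left h1 (by positivity)).trans hkey

/-- the majorant sums to `e^{M}·δ`. [folklore] -/
theorem hasSum_gLipTerm {M : ℝ} (δ : ℝ) : HasSum (gLipTerm M δ) (Real.exp M * δ) := by
  have h := exp_series_hasSum_exp' (𝕂 := ℝ) M
  rw [← Real.exp_eq_exp_ℝ] at h
  have h' : HasSum (fun m : ℕ => M ^ m / (m ! : ℝ) * δ) (Real.exp M * δ) := by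
    have h2 := h.mul_right δ
    refine h2.congr_fun fun m => ?_
    rw [smul_eq_mul, div_eq_inv_mul]
  have hshift : HasSum (fun m : ℕ => gLipTerm M δ (m + 1)) (Real.exp M * δ - ∑ i ∈ Finset.range 1, gLipTerm M δ i) := by
    have e0 : ∑ i ∈ Finset.range 1, gLipTerm M δ i = 0 := by simp [gLipTerm]
    rw [e0, sub_zero]
    refine h'.congr_fun fun m => ?_
    rw [gLipTerm, if_neg (Nat.succ_ne_zero m), Nat.add_sub_cancel]
  exact (hasSum_nat_add_iff' 1).mp hshift

/-- **`g` IS LOCALLY LIPSCHITZ**: `‖g(A) − g(B)‖ ≤ e^{max(‖A‖,‖B‖)}·‖A − B‖`. [folklore] -/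
theorem norm_gFun_sub_gFun_le (A B : 𝔸) : ‖gFun A - gFun B‖ ≤ Real.exp (max ‖A‖ ‖B‖) * ‖A - B‖ := by
  have hsub : gFun A - gFun B = ∑' n : ℕ, ((-1 : ℂ) ^ n / ((n + 1)! : ℂ)) • (A ^ n - B ^ n) := by
    rw [gFun, gFun, ← (summable_gFun A).tsum_sub (summable_gFun B)]
    exact tsum_congr fun n => (smul_sub _ _ _).symm
  rw [hsub]
  exact tsum_of_norm_bounded (hasSum_gLipTerm ‖A - B‖) (norm_gTerm_sub_le A B)

/-- on the ball `‖·‖ ≤ y ≤ 1/4`: `‖g(A) − g(B)‖ ≤ (3/2)‖A − B‖`. [folklore] -/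
theorem norm_gFun_sub_gFun_le_of_le {A B : 𝔸} {y : ℝ} (hy0 : 0 ≤ y) (hy : y ≤ 1 / 4) (hA : ‖A‖ ≤ y) (hB : ‖B‖ ≤ y) :
    ‖gFun A - gFun B‖ ≤ 3 / 2 * ‖A - B‖ := by
  have h1 := norm_gFun_sub_gFun_le A B
  have h2 : Real.exp (max ‖A‖ ‖B‖) ≤ 3 / 2 := by
    have h3 : Real.exp (max ‖A‖ ‖B‖) ≤ Real.exp y := Real.exp_le_exp.mpr (max_le hA hB)
    have h4 := exp_sub_one_le_two_mul hy0 hy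
    linarith
  exact h1.trans (mul_le_mul_of_nonneg_right h2 (norm_nonneg _))

/-! ## §2 The Neumann inverse and products are Lipschitz -/

omit [NormedAlgebra ℂ 𝔸] in
/-- **THE INVERSE IS LIPSCHITZ NEAR `1`**: `‖a⁻¹ − b⁻¹‖ ≤ 4‖a − b‖` for `‖a − 1‖, ‖b − 1‖ ≤ 1/2` (`a⁻¹ − b⁻¹ = a⁻¹(b − a)b⁻¹`, `‖a⁻¹‖, ‖b⁻¹‖ ≤ 2`). [folklore] -/
theorem norm_inverse_sub_inverse_le {a b : 𝔸} (ha : ‖a - 1‖ ≤ 1 / 2) (hb : ‖b - 1‖ ≤ 1 / 2) :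
    ‖Ring.inverse a - Ring.inverse b‖ ≤ 4 * ‖a - b‖ := by
  have hua := norm_inverse_sub_one_le ha (by norm_num : (1 : ℝ) / 2 < 1)
  have hub := norm_inverse_sub_one_le hb (by norm_num : (1 : ℝ) / 2 < 1)
  obtain ⟨ua, rfl⟩ := hua.1
  obtain ⟨ub, rfl⟩ := hub.1
  rw [Ring.inverse_unit, Ring.inverse_unit] at *
  have hna : ‖(↑ua⁻¹ : 𝔸)‖ ≤ 2 := by
    have h := norm_le_insert' (↑ua⁻¹ : 𝔸) (1 : 𝔸)
    rw [norm_one] at h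
    have h2 : ((1 : ℝ) / 2) / (1 - 1 / 2) = 1 := by norm_num
    linarith [hua.2]
  have hnb : ‖(↑ub⁻¹ : 𝔸)‖ ≤ 2 := by
    have h := norm_le_insert' (↑ub⁻¹ : 𝔸) (1 : 𝔸)
    rw [norm_one] at h
    have h2 : ((1 : ℝ) / 2) / (1 - 1 / 2) = 1 := by norm_num
    linarith [hub.2]
  have e : (↑ua⁻¹ : 𝔸) - ↑ub⁻¹ = ↑ua⁻¹ * ((ub : 𝔸) - ua) * ↑ub⁻¹ := by
    rw [mul_sub, sub_mul, Units.inv_mul, one_mul, mul_assoc, Units.mul_inv, mul_one]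
  rw [e]
  calc ‖(↑ua⁻¹ : 𝔸) * ((ub : 𝔸) - ua) * ↑ub⁻¹‖ ≤ ‖(↑ua⁻¹ : 𝔸)‖ * ‖(ub : 𝔸) - ua‖ * ‖(↑ub⁻¹ : 𝔸)‖ :=
        (norm_mul_le _ _).trans (mul_le_mul_of_nonneg_right (norm_mul_le _ _) (norm_nonneg _))
    _ ≤ 2 * ‖(ub : 𝔸) - ua‖ * 2 := by gcongr
    _ = 4 * ‖(ua : 𝔸) - ub‖ := by rw [← norm_neg, neg_sub]; ring

-- products are Lipschitz: `‖PQ − P′Q′‖ ≤ ‖P − P′‖‖Q‖ + ‖P′‖‖Q − Q′‖` is the tree's `TermwiseBackground.norm_mul_sub_mul_le'` (reused; dedup dry-run).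

/-! ## §2b The logarithm (21) is Lipschitz near `1` -/

/-- the real majorant of the termwise differences of `log`: `0, δ, δ/2, δ/4, …` on the ball of radius `1/2`. [folklore] -/
def logLipTerm (δ : ℝ) (n : ℕ) : ℝ := if n = 0 then 0 else (1 / 2) ^ (n - 1) * δ

omit [CompleteSpace 𝔸] in
/-- termwise: `‖c_n((X−1)ⁿ − (X′−1)ⁿ)‖ ≤ logLipTerm ‖X − X′‖ n` when `‖X − 1‖, ‖X′ − 1‖ ≤ 1/2` (`|c_n| = 1/n`, `‖xⁿ − x′ⁿ‖ ≤ n(1/2)ⁿ⁻¹‖x − x′‖`). [folklore] -/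
theorem norm_logTerm_sub_le {X X' : 𝔸} (hX : ‖X - 1‖ ≤ 1 / 2) (hX' : ‖X' - 1‖ ≤ 1 / 2) (n : ℕ) :
    ‖logSeriesCoeff n • ((X - 1) ^ n - (X' - 1) ^ n)‖ ≤ logLipTerm ‖X - X'‖ n := by
  cases n with
  | zero => simp [logLipTerm]
  | succ m =>
    rw [logLipTerm, if_neg (Nat.succ_ne_zero m), Nat.add_sub_cancel, norm_smul]
    have h1 := norm_pow_succ_sub_pow_succ_le (X - 1) (X' - 1) m
    have hmax : max ‖X - 1‖ ‖X' - 1‖ ≤ 1 / 2 := max_le hX hX'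
    have hd : (X - 1) - (X' - 1) = X - X' := by abel
    rw [hd] at h1
    have hc : ‖logSeriesCoeff (m + 1)‖ = 1 / (m + 1) := by
      rw [logSeriesCoeff, norm_div, norm_pow, norm_neg, norm_one, one_pow, Complex.norm_natCast, Nat.cast_succ]
    rw [hc]
    have hm1 : (0 : ℝ) < m + 1 := by positivity
    have hpow : max ‖X - 1‖ ‖X' - 1‖ ^ m ≤ (1 / 2) ^ m := pow_le_pow_left₀ (le_max_of_le_left (norm_nonneg _)) hmax m
    calc 1 / (m + 1 : ℝ) * ‖(X - 1) ^ (m + 1) - (X' - 1) ^ (m + 1)‖ ≤ 1 / (m + 1 : ℝ) * ((m + 1) * max ‖X - 1‖ ‖X' - 1‖ ^ m * ‖X - X'‖) :=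
          mul_le_mul_of_nonneg_left h1 (by positivity)
      _ = max ‖X - 1‖ ‖X' - 1‖ ^ m * ‖X - X'‖ := by field_simp
      _ ≤ (1 / 2) ^ m * ‖X - X'‖ := mul_le_mul_of_nonneg_right hpow (norm_nonneg _)

/-- the majorant sums to `2δ`. [folklore] -/
theorem hasSum_logLipTerm (δ : ℝ) : HasSum (logLipTerm δ) (2 * δ) := by
  have h : HasSum (fun m : ℕ => ((1 : ℝ) / 2) ^ m * δ) (2 * δ) := by
    have h1 := (hasSum_geometric_of_lt_one (by norm_num : (0 : ℝ) ≤ 1 / 2) (by norm_num : (1 : ℝ) / 2 < 1)).mul_right δ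
    have e : ((1 : ℝ) - 1 / 2)⁻¹ * δ = 2 * δ := by norm_num
    rwa [e] at h1
  have hshift : HasSum (fun m : ℕ => logLipTerm δ (m + 1)) (2 * δ - ∑ i ∈ Finset.range 1, logLipTerm δ i) := by
    have e0 : ∑ i ∈ Finset.range 1, logLipTerm δ i = 0 := by simp [logLipTerm]
    rw [e0, sub_zero]
    refine h.congr_fun fun m => ?_
    rw [logLipTerm, if_neg (Nat.succ_ne_zero m), Nat.add_sub_cancel]
  exact (hasSum_nat_add_iff' 1).mp hshift

omit [NormOneClass 𝔸] in
/-- helper: the difference of two convergent logarithmic series is the series of the differences. [folklore] -/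
theorem mlog_sub_mlog_eq_tsum {X X' : 𝔸} (hX : ‖X - 1‖ < 1) (hX' : ‖X' - 1‖ < 1) :
    mlog X - mlog X' = ∑' n : ℕ, logSeriesCoeff n • ((X - 1) ^ n - (X' - 1) ^ n) := by
  rw [← (hasSum_mlog hX).tsum_eq, ← (hasSum_mlog hX').tsum_eq, ← (hasSum_mlog hX).summable.tsum_sub (hasSum_mlog hX').summable]
  exact tsum_congr fun n => (smul_sub _ _ _).symm

/-- **THE LOGARITHM IS LIPSCHITZ NEAR `1`**: `‖log X − log X′‖ ≤ 2‖X − X′‖` for `‖X − 1‖, ‖X′ − 1‖ ≤ 1/2`. [cite: Balaban1985Averaging, (21)/(26) pp.21–22 (the series)] [folklore] -/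
theorem norm_mlog_sub_mlog_le {X X' : 𝔸} (hX : ‖X - 1‖ ≤ 1 / 2) (hX' : ‖X' - 1‖ ≤ 1 / 2) : ‖mlog X - mlog X'‖ ≤ 2 * ‖X - X'‖ := by
  rw [mlog_sub_mlog_eq_tsum (hX.trans_lt (by norm_num)) (hX'.trans_lt (by norm_num))]
  exact tsum_of_norm_bounded (hasSum_logLipTerm ‖X - X'‖) (norm_logTerm_sub_le hX hX')

/-! ## §3 The three coefficient shapes are Lipschitz on the small ball -/

section Coeff

variable {y δ : ℝ}

/-- size of `g` on the ball: `‖g(A)‖ ≤ 3/2`. [folklore] -/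
theorem norm_gFun_le (hy0 : 0 ≤ y) (hy : y ≤ 1 / 4) {A : 𝔸} (hA : ‖A‖ ≤ y) : ‖gFun A‖ ≤ 3 / 2 := by
  have hgA : ‖gFun A - 1‖ ≤ 2 * y :=
    (norm_gFun_sub_one_le A).trans ((sub_le_sub_right (Real.exp_le_exp.mpr hA) 1).trans (exp_sub_one_le_two_mul hy0 hy))
  have h := norm_le_insert' (gFun A) (1 : 𝔸)
  rw [norm_one] at h
  linarith

/-- `g(A)` is within `1/2` of `1` on the ball. [folklore] -/
theorem norm_gFun_sub_one_le_half (hy0 : 0 ≤ y) (hy : y ≤ 1 / 4) {A : 𝔸} (hA : ‖A‖ ≤ y) : ‖gFun A - 1‖ ≤ 1 / 2 :=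
  ((norm_gFun_sub_one_le A).trans ((sub_le_sub_right (Real.exp_le_exp.mpr hA) 1).trans (exp_sub_one_le_two_mul hy0 hy))).trans (by linarith)

/-- size of `g(B)⁻¹` on the ball: `≤ 2`. [folklore] -/
theorem norm_inverse_gFun_le (hy0 : 0 ≤ y) (hy : y ≤ 1 / 4) {B : 𝔸} (hB : ‖B‖ ≤ y) : ‖Ring.inverse (gFun B)‖ ≤ 2 := by
  have hgB := norm_gFun_sub_one_le_half hy0 hy hB
  have hinv := (norm_inverse_sub_one_le hgB (by norm_num : (1 : ℝ) / 2 < 1)).2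
  have h := norm_le_insert' (Ring.inverse (gFun B)) (1 : 𝔸)
  rw [norm_one] at h
  have h2 : ((1 : ℝ) / 2) / (1 - 1 / 2) = 1 := by norm_num
  linarith

/-- `g(B)⁻¹` is Lipschitz on the ball: `≤ 6‖B − B′‖`. [folklore] -/
theorem norm_inverse_gFun_sub_le (hy0 : 0 ≤ y) (hy : y ≤ 1 / 4) {B B' : 𝔸} (hB : ‖B‖ ≤ y) (hB' : ‖B'‖ ≤ y) :
    ‖Ring.inverse (gFun B) - Ring.inverse (gFun B')‖ ≤ 6 * ‖B - B'‖ := by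
  have h := norm_inverse_sub_inverse_le (norm_gFun_sub_one_le_half hy0 hy hB) (norm_gFun_sub_one_le_half hy0 hy hB')
  have h2 := norm_gFun_sub_gFun_le_of_le hy0 hy hB hB'
  linarith

/-- size of `e^{C}` on the ball: `≤ 3/2`. [folklore] -/
theorem norm_exp_le_of_le (hy0 : 0 ≤ y) (hy : y ≤ 1 / 4) {C : 𝔸} (hC : ‖C‖ ≤ y) : ‖exp C‖ ≤ 3 / 2 := by
  have heC : ‖exp C - 1‖ ≤ 2 * y :=
    (norm_exp_sub_one_le C).trans ((sub_le_sub_right (Real.exp_le_exp.mpr hC) 1).trans (exp_sub_one_le_two_mul hy0 hy))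
  have h := norm_le_insert' (exp C) (1 : 𝔸)
  rw [norm_one] at h
  linarith

/-- `e^{C}` is Lipschitz on the ball: `≤ (3/2)‖C − C′‖`. [folklore] -/
theorem norm_exp_sub_exp_le_of_le' (hy0 : 0 ≤ y) (hy : y ≤ 1 / 4) {C C' : 𝔸} (hC : ‖C‖ ≤ y) (hC' : ‖C'‖ ≤ y) :
    ‖exp C - exp C'‖ ≤ 3 / 2 * ‖C - C'‖ := by
  have h1 := norm_exp_sub_exp_le C C'
  have h2 : Real.exp (max ‖C‖ ‖C'‖) ≤ 3 / 2 := by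
    have h3 : Real.exp (max ‖C‖ ‖C'‖) ≤ Real.exp y := Real.exp_le_exp.mpr (max_le hC hC')
    have h4 := exp_sub_one_le_two_mul hy0 hy
    linarith
  calc ‖exp C - exp C'‖ ≤ ‖C - C'‖ * Real.exp (max ‖C‖ ‖C'‖) := h1
    _ ≤ ‖C - C'‖ * (3 / 2) := mul_le_mul_of_nonneg_left h2 (norm_nonneg _)
    _ = 3 / 2 * ‖C - C'‖ := mul_comm _ _

/-- **THE FIRST COEFFICIENT IS LIPSCHITZ**: on the ball `‖·‖ ≤ y ≤ 1/4`, arguments within `δ` give `‖(g(A)g(B)⁻¹ − 1) − (g(A′)g(B′)⁻¹ − 1)‖ ≤ 24δ`. [folklore] -/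
theorem norm_coeff₁_sub_le (hy0 : 0 ≤ y) (hy : y ≤ 1 / 4) {A B A' B' : 𝔸} (hA : ‖A‖ ≤ y) (hB : ‖B‖ ≤ y) (hA' : ‖A'‖ ≤ y) (hB' : ‖B'‖ ≤ y)
    (hdA : ‖A - A'‖ ≤ δ) (hdB : ‖B - B'‖ ≤ δ) :
    ‖(gFun A * Ring.inverse (gFun B) - 1) - (gFun A' * Ring.inverse (gFun B') - 1)‖ ≤ 24 * δ := by
  have hδ : 0 ≤ δ := (norm_nonneg _).trans hdA
  rw [sub_sub_sub_cancel_right]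
  have h := norm_mul_sub_mul_le' (gFun A) (Ring.inverse (gFun B)) (gFun A') (Ring.inverse (gFun B'))
  have h1 := norm_gFun_sub_gFun_le_of_le hy0 hy hA hA'
  have h2 := norm_inverse_gFun_le hy0 hy hB
  have h3 := norm_gFun_le hy0 hy hA'
  have h4 := norm_inverse_gFun_sub_le hy0 hy hB hB'
  have h5 : ‖gFun A - gFun A'‖ * ‖Ring.inverse (gFun B)‖ ≤ (3 / 2 * δ) * 2 :=
    mul_le_mul (h1.trans (by linarith)) h2 (norm_nonneg _) (by positivity)
  have h6 : ‖gFun A'‖ * ‖Ring.inverse (gFun B) - Ring.inverse (gFun B')‖ ≤ (3 / 2) * (6 * δ) :=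
    mul_le_mul h3 (h4.trans (by linarith)) (norm_nonneg _) (by positivity)
  linarith

/-- **THE SECOND COEFFICIENT IS LIPSCHITZ**: `‖(g(A)g(B)⁻¹e^{C} − 1) − (g(A′)g(B′)⁻¹e^{C′} − 1)‖ ≤ 24δ` on the ball. [folklore] -/
theorem norm_coeff₂_sub_le (hy0 : 0 ≤ y) (hy : y ≤ 1 / 4) {A B C A' B' C' : 𝔸} (hA : ‖A‖ ≤ y) (hB : ‖B‖ ≤ y) (hC : ‖C‖ ≤ y) (hA' : ‖A'‖ ≤ y) (hB' : ‖B'‖ ≤ y)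
    (hC' : ‖C'‖ ≤ y) (hdA : ‖A - A'‖ ≤ δ) (hdB : ‖B - B'‖ ≤ δ) (hdC : ‖C - C'‖ ≤ δ) :
    ‖(gFun A * Ring.inverse (gFun B) * exp C - 1) - (gFun A' * Ring.inverse (gFun B') * exp C' - 1)‖ ≤ 24 * δ := by
  have hδ : 0 ≤ δ := (norm_nonneg _).trans hdA
  rw [sub_sub_sub_cancel_right]
  -- the pair `X = g(A)g(B)⁻¹`
  have hX : ‖gFun A * Ring.inverse (gFun B) - gFun A' * Ring.inverse (gFun B')‖ ≤ 12 * δ := by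
    have h := norm_mul_sub_mul_le' (gFun A) (Ring.inverse (gFun B)) (gFun A') (Ring.inverse (gFun B'))
    have h5 : ‖gFun A - gFun A'‖ * ‖Ring.inverse (gFun B)‖ ≤ (3 / 2 * δ) * 2 :=
      mul_le_mul ((norm_gFun_sub_gFun_le_of_le hy0 hy hA hA').trans (by linarith)) (norm_inverse_gFun_le hy0 hy hB) (norm_nonneg _) (by positivity)
    have h6 : ‖gFun A'‖ * ‖Ring.inverse (gFun B) - Ring.inverse (gFun B')‖ ≤ (3 / 2) * (6 * δ) :=
      mul_le_mul (norm_gFun_le hy0 hy hA') ((norm_inverse_gFun_sub_le hy0 hy hB hB').trans (by linarith)) (norm_nonneg _) (by positivity)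
    linarith
  have hX' : ‖gFun A' * Ring.inverse (gFun B')‖ ≤ 3 := by
    have := norm_mul_le (gFun A') (Ring.inverse (gFun B'))
    have h3 := norm_gFun_le hy0 hy hA'
    have h2 := norm_inverse_gFun_le hy0 hy hB'
    nlinarith [norm_nonneg (gFun A'), norm_nonneg (Ring.inverse (gFun B'))]
  have h := norm_mul_sub_mul_le' (gFun A * Ring.inverse (gFun B)) (exp C) (gFun A' * Ring.inverse (gFun B')) (exp C')
  have h7 : ‖gFun A * Ring.inverse (gFun B) - gFun A' * Ring.inverse (gFun B')‖ * ‖exp C‖ ≤ (12 * δ) * (3 / 2) :=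
    mul_le_mul hX (norm_exp_le_of_le hy0 hy hC) (norm_nonneg _) (by positivity)
  have h8 : ‖gFun A' * Ring.inverse (gFun B')‖ * ‖exp C - exp C'‖ ≤ 3 * (3 / 2 * δ) :=
    mul_le_mul hX' ((norm_exp_sub_exp_le_of_le' hy0 hy hC hC').trans (by linarith)) (norm_nonneg _) (by positivity)
  linarith

/-- **THE THIRD COEFFICIENT IS LIPSCHITZ**: `‖(e^{C} − g(A)Σ w_x g(B_x)⁻¹) − (e^{C′} − g(A′)Σ w_x g(B′_x)⁻¹)‖ ≤ 24δ` on the ball, for a probability weight `w`. [folklore] -/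
theorem norm_coeff₃_sub_le {ι : Type*} (s : Finset ι) {w : ι → ℝ} (hw0 : ∀ x ∈ s, 0 ≤ w x) (hw1 : ∑ x ∈ s, w x = 1) (hy0 : 0 ≤ y) (hy : y ≤ 1 / 4)
    {A C A' C' : 𝔸} {B B' : ι → 𝔸} (hA : ‖A‖ ≤ y) (hC : ‖C‖ ≤ y) (hB : ∀ x ∈ s, ‖B x‖ ≤ y) (hA' : ‖A'‖ ≤ y) (hC' : ‖C'‖ ≤ y) (hB' : ∀ x ∈ s, ‖B' x‖ ≤ y)
    (hdA : ‖A - A'‖ ≤ δ) (hdC : ‖C - C'‖ ≤ δ) (hdB : ∀ x ∈ s, ‖B x - B' x‖ ≤ δ) :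
    ‖(exp C - gFun A * ∑ x ∈ s, (w x : ℂ) • Ring.inverse (gFun (B x))) - (exp C' - gFun A' * ∑ x ∈ s, (w x : ℂ) • Ring.inverse (gFun (B' x)))‖ ≤ 24 * δ := by
  have hδ : 0 ≤ δ := (norm_nonneg _).trans hdA
  set m := ∑ x ∈ s, (w x : ℂ) • Ring.inverse (gFun (B x)) with hm
  set m' := ∑ x ∈ s, (w x : ℂ) • Ring.inverse (gFun (B' x)) with hm'
  have hmn : ‖m‖ ≤ 2 := by
    calc ‖m‖ ≤ ∑ x ∈ s, ‖(w x : ℂ) • Ring.inverse (gFun (B x))‖ := norm_sum_le _ _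
      _ ≤ ∑ x ∈ s, w x * 2 := Finset.sum_le_sum fun x hx => by
          rw [norm_smul, Complex.norm_real, Real.norm_of_nonneg (hw0 x hx)]
          exact mul_le_mul_of_nonneg_left (norm_inverse_gFun_le hy0 hy (hB x hx)) (hw0 x hx)
      _ = 2 := by rw [← Finset.sum_mul, hw1, one_mul]
  have hmd : ‖m - m'‖ ≤ 6 * δ := by
    have e : m - m' = ∑ x ∈ s, (w x : ℂ) • (Ring.inverse (gFun (B x)) - Ring.inverse (gFun (B' x))) := by
      rw [hm, hm', ← Finset.sum_sub_distrib]
      exact Finset.sum_congr rfl fun x _ => (smul_sub _ _ _).symm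
    rw [e]
    calc ‖∑ x ∈ s, (w x : ℂ) • (Ring.inverse (gFun (B x)) - Ring.inverse (gFun (B' x)))‖
        ≤ ∑ x ∈ s, ‖(w x : ℂ) • (Ring.inverse (gFun (B x)) - Ring.inverse (gFun (B' x)))‖ := norm_sum_le _ _
      _ ≤ ∑ x ∈ s, w x * (6 * δ) := Finset.sum_le_sum fun x hx => by
          rw [norm_smul, Complex.norm_real, Real.norm_of_nonneg (hw0 x hx)]
          exact mul_le_mul_of_nonneg_left ((norm_inverse_gFun_sub_le hy0 hy (hB x hx) (hB' x hx)).trans (by linarith [hdB x hx])) (hw0 x hx)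
      _ = 6 * δ := by rw [← Finset.sum_mul, hw1, one_mul]
  have e : (exp C - gFun A * m) - (exp C' - gFun A' * m') = (exp C - exp C') - (gFun A * m - gFun A' * m') := by abel
  rw [e]
  have h1 := norm_exp_sub_exp_le_of_le' hy0 hy hC hC'
  have h := norm_mul_sub_mul_le' (gFun A) m (gFun A') m'
  have h5 : ‖gFun A - gFun A'‖ * ‖m‖ ≤ (3 / 2 * δ) * 2 :=
    mul_le_mul ((norm_gFun_sub_gFun_le_of_le hy0 hy hA hA').trans (by linarith)) hmn (norm_nonneg _) (by positivity)
  have h6 : ‖gFun A'‖ * ‖m - m'‖ ≤ (3 / 2) * (6 * δ) := mul_le_mul (norm_gFun_le hy0 hy hA') hmd (norm_nonneg _) (by positivity)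
  refine (norm_sub_le _ _).trans ?_
  linarith

end Coeff

end Summit.QuantumFields.BalabanUV.T4Continuum.NE2.OneStepRemainderCoefficientsLipschitz

end
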